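import Mathlib
import HarnessLib
import Summits.HubbardSuperconductivity.HubbardSuperconductivity.Theorems.WeakCouplingBCSDefsKlU0Window
import Summits.HubbardSuperconductivity.HubbardSuperconductivity.Theorems.WeakCouplingBCSDefsKlU0WindowRecord
import Summits.HubbardSuperconductivity.HubbardSuperconductivity.Theorems.WeakCouplingBCSDefsKlU0WindowYXRecord
import Summits.HubbardSuperconductivity.HubbardSuperconductivity.Theorems.WeakCouplingBCSDefsKlU0WindowZRecord
import Summits.HubbardSuperconductivity.HubbardSuperconductivity.Theorems.WeakCouplingBCSWcbcsKohnLuttingerB1gFormAWindowD005D030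

/-!
# Route `WeakCouplingBCS` — channel-margin lane of the Kohn–Luttinger certificate (`WcbcsKohnLuttingerB1g`,
# stmt-HubbardSuperconductivity-0158): explicit `U₀` on the JOINED window `μ ∈ [-0.7275, -0.1775] ⊃ μ([0.10, 0.30])`

The concatenation, `μ` ascending, of `klU0WindowYXRows` (`[-0.7275, -0.5725]`, 47 rows = the boxes of `klCertB1gWinY/X`) and `klU0WindowZRows`
(`[-0.5725, -0.42749]`, 29 rows = the boxes of `klCertB1gWinZ`) — both margin-1 g9, U0-TABLE v4 §B, certified two-loop allowances + chain layer per box — with the v3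
`klU0WindowRows` (`[-0.42749, -0.1775]`, 44 rows, margin-1 g6): 120 rows; its uniform threshold `klU0WindowD010D030U` = the smallest row threshold (still the v3
value `1145/2²⁴`, attained in `klU0WindowRows`: every new row lies above it); the kernel decision `klU0WinCheck` (contiguity, cover of `[-291/400, -71/400]`, every row
`ok` with `U0 ≥ u`); the soundness corollary and its doping form on `δ ∈ [0.10, 0.30]` (`muOfDoping_mem_window_d010_d030`).  Selection THEOREMS on the join:
`Theorems/WeakCouplingBCSKlSelectionWindowD010D030.lean`.  `C4 = 10` ASSUMED in every row; existence-grade numbers; nothing in this file asserts superconductivity.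
Cell file: U0-TABLE.md v4 §B (gate-hubbard-kl, margin-1 g9).
-/

noncomputable section

-- the tree's namespace `Summit.<Summit>.<Problem>.Theorems` repeats the summit name by design (D-0017)
set_option linter.dupNamespace false

namespace Summit.HubbardSuperconductivity.HubbardSuperconductivity.Theorems

/-- The joined window rows, `μ` ascending: `klU0WindowYXRows` (47 rows, u = 5801/16777216); `klU0WindowZRows` (29 rows, u = 5657/16777216); `klU0WindowRows` (44 rows, u = 1145/16777216). [folklore] -/
def klU0WindowD010D030Rows : List KLU0WinRow :=
  klU0WindowYXRows ++ klU0WindowZRows ++ klU0WindowRows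

/-- The uniform threshold of the joined window = the smallest of the pieces' thresholds (attained in `klU0WindowRows`): `1145/16777216 ≈ 6.825e-05`. [folklore] -/
def klU0WindowD010D030U : ℚ := ((1145 : ℚ) / 16777216)

/-- Kernel decision: the 120 boxes of `klU0WindowD010D030Rows` are contiguous, cover `[-291/400, -71/400]`, every row passes `KLU0Row.ok` and has `U0 ≥ klU0WindowD010D030U`. [folklore] -/
theorem klU0WindowD010D030Rows_check : klU0WinCheck ((-291 : ℚ) / 400) ((-71 : ℚ) / 400) klU0WindowD010D030U klU0WindowD010D030Rows = true := by
  decide +kernel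

/-- **Explicit `U₀` on the joined window `μ ∈ [-0.7275, -0.1775]` (modulo the rows' named hypotheses)**: for every such `μ` a row of
`klU0WindowD010D030Rows` whose box contains `μ` such that for any real `lamB, lamX` obeying that row's certified expansion bounds against a competitor channel (intended: the
`B1g` and `χ ∈ {A1g, A2g, B2g, E}` bottoms of the pp-irreducible Cooper vertex `Γ_U/U²` through third order, chains resummed, at the level `μ`),
`lamB U < lamX U` for all `0 < U ≤ klU0WindowD010D030U ≈ 6.825e-05` — ONE threshold for the whole window. [cite: ScalapinoLohHirsch1986, (3)-(4)] -/
theorem klU0WindowD010D030_sound :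
    ∀ μ : ℝ, ((((-291 : ℚ) / 400) : ℚ) : ℝ) ≤ μ → μ ≤ ((((-71 : ℚ) / 400) : ℚ) : ℝ) →
      ∃ r ∈ klU0WindowD010D030Rows, ((r.mulo : ℚ) : ℝ) ≤ μ ∧ μ ≤ ((r.muhi : ℚ) : ℝ) ∧
        ∀ c ∈ r.row.chans, ∀ lamB lamX : ℝ → ℝ,
          (∀ U : ℝ, 0 < U → U ≤ r.row.U1 → lamB U ≤ r.row.rhohi + U * (r.row.c3B + r.row.tB) + U ^ 2 * (r.row.c4B + r.row.C4)) →
          (∀ U : ℝ, 0 < U → U ≤ r.row.U1 → (c.low : ℝ) - U * (c.s3 + c.t) - U ^ 2 * (c.s4 + r.row.C4) ≤ lamX U) →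
          ∀ U : ℝ, 0 < U → U ≤ klU0WindowD010D030U → lamB U < lamX U :=
  klU0Win_sound _ _ _ _ klU0WindowD010D030Rows_check

open Literature.MathematicalPhysics.QuantumLattice in
/-- **The same on the doping window `δ ∈ [0.10, 0.30]`** (certified fillings n(-0.7275) < 7/10, n(-0.1775) ≥ 9/10, `muOfDoping_mem_window_d010_d030`): for every such `δ` a row's box contains
`μ(δ) = chemicalPotentialOfDensity ε₀ (1-δ)` and, modulo that row's named hypotheses, `B1g` stays strictly lowest for `0 < U ≤ klU0WindowD010D030U`.
[cite: ScalapinoLohHirsch1986, (3)-(4)] -/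
theorem klU0WindowD010D030_sound_doping (δ : ℝ) (hδ : δ ∈ Set.Icc (0.10 : ℝ) 0.30) :
    ∃ r ∈ klU0WindowD010D030Rows, ((r.mulo : ℚ) : ℝ) ≤ chemicalPotentialOfDensity (squareDispersion 1 0) (1 - δ) ∧
      chemicalPotentialOfDensity (squareDispersion 1 0) (1 - δ) ≤ ((r.muhi : ℚ) : ℝ) ∧
        ∀ c ∈ r.row.chans, ∀ lamB lamX : ℝ → ℝ,
          (∀ U : ℝ, 0 < U → U ≤ r.row.U1 → lamB U ≤ r.row.rhohi + U * (r.row.c3B + r.row.tB) + U ^ 2 * (r.row.c4B + r.row.C4)) →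
          (∀ U : ℝ, 0 < U → U ≤ r.row.U1 → (c.low : ℝ) - U * (c.s3 + c.t) - U ^ 2 * (c.s4 + r.row.C4) ≤ lamX U) →
          ∀ U : ℝ, 0 < U → U ≤ klU0WindowD010D030U → lamB U < lamX U := by
  obtain ⟨h₁, h₂⟩ := muOfDoping_mem_window_d010_d030 δ hδ
  exact klU0WindowD010D030_sound _ (by push_cast; linarith) (by push_cast; linarith)

end Summit.HubbardSuperconductivity.HubbardSuperconductivity.Theorems

end
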